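import Summits.AtomisticToContinuum.HydrodynamicLimit.Theorems.TwoClocksEquilibriumShearWindowLDAllWindows
import Summits.AtomisticToContinuum.HydrodynamicLimit.Theorems.OneFlightGossipEngineKineticCurrentsWindowLDApriori
import Literature.MathematicalPhysics.KineticTheory.HardSphereEuler
import HarnessLib

/-!
# Window upgrade at equilibrium for a general fast functional (stub `stub_windowUpgrade`)

Crux `Summit.AtomisticToContinuum.HydrodynamicLimit.Theses.TwoClocks.TransferEntropyClock` (stmt-AtomisticToContinuum-16625),
line `Sketch`, registered stub S3x `stub_windowUpgrade : WindowUpgrade` (def re-declared verbatim from the line skeleton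
`Cruxes/TransferEntropyClock/Lines/Sketch.lean` v2, this file's namespace).

**What.** Under the constant-profile (global canonical, flow-invariant) Gibbs law
`G_N = localGibbsLaw σ a₀ u₀ θ₀ N Φ_N`, for a continuous one-body observable `F` of quadratic growth
`|F(x,v)| ≤ C(1+‖v‖²)` and the window exponential moment
`M_N(τ) = ∫ exp(β ∑ᵢ w⁻¹∫₀ʷ F(Φ_r z i) dr) dG_N`, `w = τ(N+1)^{-1/3}`: if for every small tilt `β`
and every `ε > 0` the bound `M_N(τ) ≤ exp(ε(N+1))` holds eventually in `N` at ONE window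
`τ = τ(β, ε)`, then (for `|β| ≤ β₁`, some `β₁ > 0`) it holds eventually in `N` at EVERY window
`τ ≥ τ₀(β, ε)` — the `∀ τ ≥ τ₀` quantifier shape the Baire-category step of the line needs for every
functional.

**How** (verbatim the `→` half of `equilibriumShearWindowLD_iff_allWindows`, with the kinetic shear
stress replaced by a general `F` and the rest frame `u₀ = 0` by a general `u₀`):
* `windowMoment_nat_mul_le`: `M_N(kτ) ≤ M_N(τ)` for `k ≥ 1` (`lintegral_exp_window_nat_mul_le`,
  the Gibbs law being carried by the good set, `localGibbsLaw_const_compl_good`, and invariant under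
  every flow map, `measurePreserving_flow_localGibbsLaw_const`);
* `windowMoment_le_of_nat_mul_add`: `M_N(kτ₁ + r) ≤ exp((kτ₁/τ) A + (r/τ) C)` from
  `M_N(τ₁) ≤ exp A`, `M_N(r) ≤ exp C` (Hölder + invariance, `lintegral_exp_window_add_le_geomMean`);
* the a priori bound `M_N(r) ≤ exp(c(N+1))` at EVERY window `r > 0` for `|β| ≤ β₂`
  (`kineticCurrentsWindowLD_apriori`, statics);
* `β₁ := min β₀ β₂`; given `β`, `ε`, take the hypothesis' window `τ₁` at `ε/2`, `τ₀ := m τ₁` with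
  `m ≥ 2c⁺/ε`; for `τ ≥ τ₀` write `τ = kτ₁ + r`, `k = ⌊τ/τ₁⌋ ≥ m`, `0 ≤ r < τ₁`: the exponent is
  `≤ (N+1)(ε/2 + (r/τ)c⁺) ≤ (N+1)(ε/2 + c⁺/m) ≤ ε(N+1)`, with the same threshold `N₀`.

References: S. Olla, S. R. S. Varadhan, H.-T. Yau, Comm. Math. Phys. 155 (1993) 523, §2;
H. Spohn, *Large Scale Dynamics of Interacting Particles* (1991), Part I §2.3.
-/

noncomputable section

open MeasureTheory Real Set
open scoped ENNReal

namespace Summit.AtomisticToContinuum.HydrodynamicLimit.Theorems.TransferEntropyClockWindows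

open Literature.Analysis.FluidPDE Literature.MathematicalPhysics.KineticTheory

/-- registered stub signature S3x of line Sketch, crux TransferEntropyClock (stmt-16625) — route-internal, not a cited fact -/
def WindowUpgrade : Prop :=
  ∀ (σ a₀ θ₀ : ℝ) (u₀ : V3), 0 < σ → σ ≤ 1 / 2 → 0 < a₀ → 0 < θ₀ →
    ∀ (Φ : (N : ℕ) → HardSphereFlow (Torus.geometry (Fin 3)) (hsDiameter σ N) (N + 1))
      (F : T3 × V3 → ℝ), Continuous F → (∃ C : ℝ, ∀ y, |F y| ≤ C * (1 + ‖y.2‖ ^ 2)) →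
    ∀ β₀ : ℝ, 0 < β₀ →
    (∀ β : ℝ, |β| ≤ β₀ → ∀ ε : ℝ, 0 < ε → ∃ τ : ℝ, 0 < τ ∧ ∃ N₀ : ℕ, ∀ N : ℕ, N₀ ≤ N →
      ∫⁻ z, ENNReal.ofReal (Real.exp (β * ∑ i : Fin (N + 1),
          (τ * ((N : ℝ) + 1) ^ (-(1 / 3 : ℝ)))⁻¹ *
            ∫ r in (0 : ℝ)..(τ * ((N : ℝ) + 1) ^ (-(1 / 3 : ℝ))), F (((Φ N).flow r z) i)))
        ∂(localGibbsLaw σ (fun _ => a₀) (fun _ => u₀) (fun _ => θ₀) N (Φ N)) ≤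
        ENNReal.ofReal (Real.exp (ε * ((N : ℝ) + 1)))) →
    ∃ β₁ : ℝ, 0 < β₁ ∧ ∀ β : ℝ, |β| ≤ β₁ → ∀ ε : ℝ, 0 < ε → ∃ τ₀ : ℝ, 0 < τ₀ ∧ ∃ N₀ : ℕ,
      ∀ τ : ℝ, τ₀ ≤ τ → ∀ N : ℕ, N₀ ≤ N →
      ∫⁻ z, ENNReal.ofReal (Real.exp (β * ∑ i : Fin (N + 1),
          (τ * ((N : ℝ) + 1) ^ (-(1 / 3 : ℝ)))⁻¹ *
            ∫ r in (0 : ℝ)..(τ * ((N : ℝ) + 1) ^ (-(1 / 3 : ℝ))), F (((Φ N).flow r z) i)))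
        ∂(localGibbsLaw σ (fun _ => a₀) (fun _ => u₀) (fun _ => θ₀) N (Φ N)) ≤
        ENNReal.ofReal (Real.exp (ε * ((N : ℝ) + 1)))

/-! ### The two structural facts for a general functional under the constant-profile Gibbs law -/

/-- **Multiples of the window do not increase the window exponential moment** of a continuous
one-body observable under the constant-profile Gibbs law `G_N = localGibbsLaw σ a₀ u₀ θ₀ N Φ`
(carried by the good set, `localGibbsLaw_const_compl_good`; invariant under every flow map,
`measurePreserving_flow_localGibbsLaw_const`): `M_N(kτ) ≤ M_N(τ)` for every `k ≥ 1`
(`lintegral_exp_window_nat_mul_le`). [folklore] -/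
theorem windowMoment_nat_mul_le (σ a₀ θ₀ : ℝ) (u₀ : V3) (N : ℕ)
    (Φ : HardSphereFlow (Torus.geometry (Fin 3)) (hsDiameter σ N) (N + 1))
    {F : T3 × V3 → ℝ} (hF : Continuous F) (β : ℝ) {τ : ℝ} (hτ : 0 < τ) (k : ℕ) (hk : 1 ≤ k) :
    ∫⁻ z, ENNReal.ofReal (Real.exp (β * ∑ i : Fin (N + 1),
        ((k : ℝ) * τ * ((N : ℝ) + 1) ^ (-(1 / 3 : ℝ)))⁻¹ *
          ∫ r in (0 : ℝ)..((k : ℝ) * τ * ((N : ℝ) + 1) ^ (-(1 / 3 : ℝ))), F (Φ.flow r z i)))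
        ∂(localGibbsLaw σ (fun _ => a₀) (fun _ => u₀) (fun _ => θ₀) N Φ) ≤
      ∫⁻ z, ENNReal.ofReal (Real.exp (β * ∑ i : Fin (N + 1),
        (τ * ((N : ℝ) + 1) ^ (-(1 / 3 : ℝ)))⁻¹ *
          ∫ r in (0 : ℝ)..(τ * ((N : ℝ) + 1) ^ (-(1 / 3 : ℝ))), F (Φ.flow r z i)))
        ∂(localGibbsLaw σ (fun _ => a₀) (fun _ => u₀) (fun _ => θ₀) N Φ) := by
  have hw : 0 < τ * ((N : ℝ) + 1) ^ (-(1 / 3 : ℝ)) :=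
    mul_pos hτ (Real.rpow_pos_of_pos (by positivity) _)
  have h := lintegral_exp_window_nat_mul_le Φ (localGibbsLaw_const_compl_good σ a₀ θ₀ u₀ N Φ) hw
    (measurePreserving_flow_localGibbsLaw_const σ a₀ θ₀ u₀ N Φ) hF β k hk
  simpa only [mul_assoc] using h

/-- **Subadditivity step for the window moment of a general functional.** Under the constant-profile
Gibbs law, for a continuous `F`, a tilt `β`, a particle number `N`, windows `τ₁ > 0`, `r > 0` and
`k ≥ 1`: if the window exponential moment is `≤ exp A` at window parameter `τ₁` and `≤ exp C` at
window parameter `r`, then at `τ = kτ₁ + r` it is `≤ exp((kτ₁/τ) A + (r/τ) C)`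
(`windowMoment_nat_mul_le` for `M(kτ₁) ≤ M(τ₁)`, then Hölder + invariance
`lintegral_exp_window_add_le_geomMean` at the windows `kτ₁ s`, `r s`, `s = (N+1)^{-1/3}`).
[folklore] -/
theorem windowMoment_le_of_nat_mul_add (σ a₀ θ₀ : ℝ) (u₀ : V3) (N : ℕ)
    (Φ : HardSphereFlow (Torus.geometry (Fin 3)) (hsDiameter σ N) (N + 1))
    {F : T3 × V3 → ℝ} (hF : Continuous F) (β : ℝ) {τ₁ r : ℝ} (hτ₁ : 0 < τ₁) (hr : 0 < r)
    {k : ℕ} (hk : 1 ≤ k) {A C : ℝ}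
    (hA : ∫⁻ z, ENNReal.ofReal (Real.exp (β * ∑ i : Fin (N + 1),
        (τ₁ * ((N : ℝ) + 1) ^ (-(1 / 3 : ℝ)))⁻¹ *
          ∫ s in (0 : ℝ)..(τ₁ * ((N : ℝ) + 1) ^ (-(1 / 3 : ℝ))), F (Φ.flow s z i)))
        ∂(localGibbsLaw σ (fun _ => a₀) (fun _ => u₀) (fun _ => θ₀) N Φ) ≤
      ENNReal.ofReal (Real.exp A))
    (hC : ∫⁻ z, ENNReal.ofReal (Real.exp (β * ∑ i : Fin (N + 1),
        (r * ((N : ℝ) + 1) ^ (-(1 / 3 : ℝ)))⁻¹ *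
          ∫ s in (0 : ℝ)..(r * ((N : ℝ) + 1) ^ (-(1 / 3 : ℝ))), F (Φ.flow s z i)))
        ∂(localGibbsLaw σ (fun _ => a₀) (fun _ => u₀) (fun _ => θ₀) N Φ) ≤
      ENNReal.ofReal (Real.exp C)) :
    ∫⁻ z, ENNReal.ofReal (Real.exp (β * ∑ i : Fin (N + 1),
        (((k : ℝ) * τ₁ + r) * ((N : ℝ) + 1) ^ (-(1 / 3 : ℝ)))⁻¹ *
          ∫ s in (0 : ℝ)..(((k : ℝ) * τ₁ + r) * ((N : ℝ) + 1) ^ (-(1 / 3 : ℝ))),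
            F (Φ.flow s z i)))
        ∂(localGibbsLaw σ (fun _ => a₀) (fun _ => u₀) (fun _ => θ₀) N Φ) ≤
      ENNReal.ofReal (Real.exp ((k : ℝ) * τ₁ / ((k : ℝ) * τ₁ + r) * A +
        r / ((k : ℝ) * τ₁ + r) * C)) := by
  set μ := localGibbsLaw σ (fun _ => a₀) (fun _ => u₀) (fun _ => θ₀) N Φ with hμ
  set sN : ℝ := ((N : ℝ) + 1) ^ (-(1 / 3 : ℝ)) with hsN
  have hsN0 : 0 < sN := Real.rpow_pos_of_pos (by positivity) _
  have hkpos : (0 : ℝ) < k := by exact_mod_cast hk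
  have hw₁ : 0 < (k : ℝ) * τ₁ * sN := by positivity
  have hw₂ : 0 < r * sN := mul_pos hr hsN0
  -- `M(k τ₁) ≤ M(τ₁) ≤ exp A`
  have hk' : ∫⁻ z, ENNReal.ofReal (Real.exp (β * ∑ i : Fin (N + 1),
        ((k : ℝ) * τ₁ * sN)⁻¹ * ∫ s in (0 : ℝ)..((k : ℝ) * τ₁ * sN), F (Φ.flow s z i))) ∂μ ≤
      ENNReal.ofReal (Real.exp A) :=
    (windowMoment_nat_mul_le σ a₀ θ₀ u₀ N Φ hF β hτ₁ k hk).trans hA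
  -- Hölder + invariance at the windows `k τ₁ sN`, `r sN`
  have hH := lintegral_exp_window_add_le_geomMean Φ (localGibbsLaw_const_compl_good σ a₀ θ₀ u₀ N Φ)
    hw₁ hw₂ (measurePreserving_flow_localGibbsLaw_const σ a₀ θ₀ u₀ N Φ _) hF β
  have hsum : (k : ℝ) * τ₁ * sN + r * sN = ((k : ℝ) * τ₁ + r) * sN := by ring
  have ha : (k : ℝ) * τ₁ * sN / ((k : ℝ) * τ₁ * sN + r * sN) =
      (k : ℝ) * τ₁ / ((k : ℝ) * τ₁ + r) := by
    rw [hsum, mul_div_mul_right _ _ hsN0.ne']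
  have hb : r * sN / ((k : ℝ) * τ₁ * sN + r * sN) = r / ((k : ℝ) * τ₁ + r) := by
    rw [hsum, mul_div_mul_right _ _ hsN0.ne']
  rw [ha, hb, hsum] at hH
  have ha0 : 0 ≤ (k : ℝ) * τ₁ / ((k : ℝ) * τ₁ + r) := by positivity
  have hb0 : 0 ≤ r / ((k : ℝ) * τ₁ + r) := by positivity
  refine hH.trans ?_
  calc (∫⁻ z, ENNReal.ofReal (Real.exp (β * ∑ i : Fin (N + 1),
          ((k : ℝ) * τ₁ * sN)⁻¹ * ∫ s in (0 : ℝ)..((k : ℝ) * τ₁ * sN), F (Φ.flow s z i))) ∂μ) ^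
          ((k : ℝ) * τ₁ / ((k : ℝ) * τ₁ + r)) *
        (∫⁻ z, ENNReal.ofReal (Real.exp (β * ∑ i : Fin (N + 1),
          (r * sN)⁻¹ * ∫ s in (0 : ℝ)..(r * sN), F (Φ.flow s z i))) ∂μ) ^
          (r / ((k : ℝ) * τ₁ + r))
      ≤ ENNReal.ofReal (Real.exp A) ^ ((k : ℝ) * τ₁ / ((k : ℝ) * τ₁ + r)) *
          ENNReal.ofReal (Real.exp C) ^ (r / ((k : ℝ) * τ₁ + r)) :=
        mul_le_mul' (ENNReal.rpow_le_rpow hk' ha0) (ENNReal.rpow_le_rpow hC hb0)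
    _ = ENNReal.ofReal (Real.exp ((k : ℝ) * τ₁ / ((k : ℝ) * τ₁ + r) * A +
          r / ((k : ℝ) * τ₁ + r) * C)) := by
        rw [ofReal_exp_rpow, ofReal_exp_rpow, ← ENNReal.ofReal_mul (Real.exp_pos _).le,
          ← Real.exp_add]

/-! ### The upgrade -/

/-- **S3x — window upgrade: `∃ τ` is as good as `∃ τ₀ ∀ τ ≥ τ₀` at equilibrium.** Under the
constant-profile Gibbs law, for a continuous `F` of quadratic growth: if for `|β| ≤ β₀` and every
`ε > 0` the window exponential moment is `≤ exp(ε(N+1))` eventually in `N` at ONE window, then for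
`|β| ≤ β₁ := min β₀ β₂` (`β₂` the a priori range of `kineticCurrentsWindowLD_apriori`,
`M_N(r) ≤ exp(c(N+1))` for all `r > 0`, `N`) it is so at EVERY window `τ ≥ τ₀(β, ε)`, with ONE threshold `N₀(β, ε)` serving all these windows (the
strong shape `∃ τ₀ ∃ N₀ ∀ τ ≥ τ₀ ∀ N ≥ N₀` the Baire step of the line consumes): take the
hypothesis' window `τ₁` at `ε/2` and `τ₀ := m τ₁` with `m ≥ 2c⁺/ε`; for `τ ≥ τ₀` write
`τ = kτ₁ + r`, `k = ⌊τ/τ₁⌋ ≥ m`, `0 ≤ r < τ₁`, and use `windowMoment_nat_mul_le` (`r = 0`) or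
`windowMoment_le_of_nat_mul_add` (`r > 0`): the exponent is
`≤ (N+1)(ε/2 + (r/τ) c⁺) ≤ (N+1)(ε/2 + c⁺/m) ≤ ε(N+1)`. [folklore] -/
theorem stub_windowUpgrade : WindowUpgrade := by
  intro σ a₀ θ₀ u₀ hσ hσ2 ha hθ Φ F hF hFC β₀ hβ₀ h₁
  obtain ⟨C, hC⟩ := hFC
  obtain ⟨β₂, hβ₂, h₂⟩ := kineticCurrentsWindowLD_apriori (fun _ => a₀) (fun _ => θ₀) (fun _ => u₀)
    continuous_const continuous_const continuous_const (fun _ => ha) (fun _ => hθ) σ hσ hσ2 Φ F C hC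
  refine ⟨min β₀ β₂, lt_min hβ₀ hβ₂, fun β hβ ε hε => ?_⟩
  obtain ⟨c, hc⟩ := h₂ β (hβ.trans (min_le_right _ _))
  obtain ⟨τ₁, hτ₁, N₀, hN₀⟩ := h₁ β (hβ.trans (min_le_left _ _)) (ε / 2) (half_pos hε)
  -- `τ₀ := m τ₁` with `m ≥ 2 c⁺ / ε`, `m ≥ 1`
  set cp : ℝ := max c 0 with hcp
  have hcp0 : 0 ≤ cp := le_max_right _ _
  set m : ℕ := ⌈2 * cp / ε⌉₊ + 1 with hm
  have hm1 : (1 : ℝ) ≤ m := by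
    rw [hm]; push_cast; linarith [Nat.cast_nonneg (α := ℝ) ⌈2 * cp / ε⌉₊]
  have hmpos : (0 : ℝ) < m := one_pos.trans_le hm1
  have hmc : 2 * cp / ε ≤ m := by
    rw [hm]; push_cast
    exact (Nat.le_ceil _).trans (le_add_of_nonneg_right zero_le_one)
  have hcm : cp / m ≤ ε / 2 := by
    rw [div_le_iff₀ hmpos]
    rw [div_le_iff₀ hε] at hmc
    linarith
  refine ⟨(m : ℝ) * τ₁, by positivity, N₀, fun τ hτ N hNN => ?_⟩
  have hτpos : 0 < τ := (mul_pos hmpos hτ₁).trans_le hτ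
  -- `τ = k τ₁ + r`, `k = ⌊τ/τ₁⌋ ≥ m ≥ 1`, `0 ≤ r < τ₁`
  set k : ℕ := ⌊τ / τ₁⌋₊ with hk
  have hq0 : 0 ≤ τ / τ₁ := (div_pos hτpos hτ₁).le
  have hkle : (k : ℝ) ≤ τ / τ₁ := Nat.floor_le hq0
  have hklt : τ / τ₁ < (k : ℝ) + 1 := Nat.lt_floor_add_one _
  have hmk : m ≤ k := Nat.le_floor (by rwa [le_div_iff₀ hτ₁])
  have hk1 : 1 ≤ k := le_trans (by exact_mod_cast hm1 : 1 ≤ m) hmk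
  have hkm : (m : ℝ) ≤ k := by exact_mod_cast hmk
  set r : ℝ := τ - (k : ℝ) * τ₁ with hr
  have hr0 : 0 ≤ r := by
    rw [hr, sub_nonneg]; rwa [le_div_iff₀ hτ₁] at hkle
  have hrτ₁ : r < τ₁ := by
    rw [hr, sub_lt_iff_lt_add]; rw [div_lt_iff₀ hτ₁] at hklt; linarith
  have hτeq : τ = (k : ℝ) * τ₁ + r := by rw [hr]; ring
  have hA := hN₀ N hNN
  have hN1 : (0 : ℝ) < (N : ℝ) + 1 := by positivity
  rcases hr0.eq_or_lt with hr00 | hrpos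
  · -- `r = 0`: `τ = k τ₁`
    have hτk : τ = (k : ℝ) * τ₁ := by rw [hτeq, ← hr00, add_zero]
    rw [hτk]
    refine (windowMoment_nat_mul_le σ a₀ θ₀ u₀ N (Φ N) hF β hτ₁ k hk1).trans (hA.trans ?_)
    exact ENNReal.ofReal_le_ofReal (Real.exp_le_exp.2 (by nlinarith))
  · -- `r > 0`: subadditivity step with the a priori bound at window `r`
    have hCr := (hc r hrpos N).trans (ENNReal.ofReal_le_ofReal (Real.exp_le_exp.2
      (mul_le_mul_of_nonneg_right (le_max_left c 0) hN1.le)))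
    rw [hτeq]
    refine (windowMoment_le_of_nat_mul_add σ a₀ θ₀ u₀ N (Φ N) hF β hτ₁ hrpos hk1 hA hCr).trans ?_
    refine ENNReal.ofReal_le_ofReal (Real.exp_le_exp.2 ?_)
    have hτ' : 0 < (k : ℝ) * τ₁ + r := by rw [← hτeq]; exact hτpos
    have ha1 : (k : ℝ) * τ₁ / ((k : ℝ) * τ₁ + r) ≤ 1 := by
      rw [div_le_one hτ']; linarith
    have hbm : r / ((k : ℝ) * τ₁ + r) ≤ 1 / m := by
      rw [div_le_div_iff₀ hτ' hmpos, one_mul]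
      nlinarith
    have h1 : (k : ℝ) * τ₁ / ((k : ℝ) * τ₁ + r) * (ε / 2 * ((N : ℝ) + 1)) ≤
        ε / 2 * ((N : ℝ) + 1) :=
      mul_le_of_le_one_left (by positivity) ha1
    have h2 : r / ((k : ℝ) * τ₁ + r) * (cp * ((N : ℝ) + 1)) ≤ ε / 2 * ((N : ℝ) + 1) := by
      calc r / ((k : ℝ) * τ₁ + r) * (cp * ((N : ℝ) + 1))
          ≤ 1 / m * (cp * ((N : ℝ) + 1)) :=
            mul_le_mul_of_nonneg_right hbm (by positivity)
        _ = cp / m * ((N : ℝ) + 1) := by ring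
        _ ≤ ε / 2 * ((N : ℝ) + 1) := mul_le_mul_of_nonneg_right hcm hN1.le
    linarith

end Summit.AtomisticToContinuum.HydrodynamicLimit.Theorems.TransferEntropyClockWindows

end
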